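import Literature.NumberTheory.LFunctions.FordLemma45Contour
import Literature.NumberTheory.LFunctions.KhaleLemma42
import Literature.NumberTheory.LFunctions.KhaleLemma63
import Literature.NumberTheory.LFunctions.ExplicitFormulaPsiCharContour
import Literature.NumberTheory.LFunctions.ExplicitFormulaPsiCharHeights
import HarnessLib

/-!
# Khale 2024, Lemma 6.5 (primitive characters): the smoothed explicit formula for `K_χ(s)`

Topic `Literature/NumberTheory/LFunctions`.  Everything in this file is PROVED (three definitions
with bodies — the smoothed prime sum `K_χ`, the contour integrand, the finite set of zeros in the
rectangle — one predicate `KhaleFarZeroSumLT`, and theorems; no named fact).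

T. Khale, *An explicit Vinogradov–Korobov zero-free region for Dirichlet L-functions*, Q. J. Math.
75 (2024) = arXiv:2210.06457v1, **Lemma 6.5** (pp. 15–16), the Dirichlet-character version of
K. Ford, *Zero-free regions for the Riemann zeta function* (2002), Lemma 4.5 (the tree's
`FordL45.re_fordK_le`, `FordLemma45Contour.lean`): for a smoothing `f ≥ 0` of compact support with
`|F₀(z)| ≤ D/|z|²` on `Re z ≥ 0`, `|z| ≥ η` (`F₀ = F − f(0)/z`, (6.5)), a Dirichlet character `χ`
modulo `q ≥ 3` and `Re s > 1`,
`K_χ(s) := Σ_n Λ(n) χ(n) n^{−s} f(log n) = −f(0) L'/L(s, χ) − Σ_ρ F₀(s − ρ) − (1 − a)(1 − δ(χ)) F₀(s)`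
`+ δ(χ) F₀(s − 1) + O(D(3.44 + ⅓ log q + ⅓ log(1 + Im s)))`, plus `I(χ)(f(0) + max f) Q(q)` for
imprimitive `χ`.  This file proves the **primitive case** (`I(χ) = δ(χ) = 0`), in the real-part form
in which Corollary 6.6 consumes it — the zeros with `|1 + it − ρ| ≤ η` kept
(`KhaleL63.nearZeros χ t η`, with multiplicity `DirichletDisc.zeroOrder`), the other non-trivial
zeros bounded through (6.5) by a bound `S` of `Σ_{|1+it−ρ|>η} m(ρ)/|1 + it − ρ|²`
(`KhaleFarZeroSumLT χ t η S`, the quantity of Lemma 6.4), and the trivial zero `ρ = 0` of an even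
character (the printed `−(1 − a)F₀(s)`) bounded by `D/|s|²`:

* `KhaleL65.re_khaleK_le` — for `χ` primitive mod `q ≥ 3`, `IsFordSmoothing f η D`,
  `0 < η ≤ 1/2`, `1 < Re s ≤ 2`, `t = Im s`:
  `Re K_χ(s) ≤ −f(0) Re L'/L(s, χ) − Σ_{|1+it−ρ|≤η} m(ρ) Re F₀(s − ρ) + D·S + D/|s|²`
  `  + D ((8.21 + log q + log(3/2))/3 + (log 2)/3 + (1/6) log(1 + t²))`
  (numerically `D(3.11 + ⅓ log q + (1/6) log(1 + t²))`, `KhaleL65.re_khaleK_le'`; the printed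
  constant is `3.44 + ⅓ log q + ⅓ log(1 + Im s)`).

The proof is the printed one (= Ford's, "we follow the proof of [6, Lemma 4.5]"):
(i) on `Re w = α ∈ (1, Re s)`, `−L'/L(w, χ) = Σ χ(n)Λ(n) n^{−w}` is integrated term by term against
`F₀(s − w)`, `J_n = n^{−s}(f(log n) − f(0))` by Laplace inversion
(`KhaleL65.integral_LSeries_twist_mul_laplace`, the character twin of Ford's (4.6),
`FordL45.integral_LSeries_vonMangoldt_mul_laplace`), so that
`(1/2π)∫ G(α + iy) dy = K_χ(s) + f(0) L'/L(s, χ)` with `G(w) = (−L'/L)(w, χ) F₀(s − w)`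
(`KhaleL65.integral_right_eq`);
(ii) the residue theorem on `[−1/2, α] × [−T, T]` (`KhaleL65.contour_identity`): for primitive
`χ ≠ χ₀`, `L(·, χ)` is entire, and the poles of `G` in the rectangle are the zeros `ρ` of `L(·, χ)`
with `Re ρ > −1/2`, i.e. the non-trivial zeros and, for even `χ`, the trivial zero `0`
(`ExplicitPsiChar.zero_eq_zero_or_mem_box`), each simple with residue `−m(ρ) F₀(s − ρ)` — this is
(6.6) before `T → ∞`;
(iii) `T → ∞` along the good heights of `ExplicitPsiChar.exists_goodHeight` (MV Lemma 12.7), on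
which `L'/L ≪ (log q(T+4))²` across the strip (`ExplicitPsiChar.exists_norm_logDeriv_LFunction_le_strip`)
while `|F₀(s − w)| ≤ D/(T − |t|)²`, so the horizontal sides tend to `0`;
(iv) the left side is bounded by **Lemma 4.2** (`KhaleL42.norm_deriv_div_LFunction_left_le`:
`|L'/L(−½ + iu, χ)| ≤ 8.21 + log q + ½ log(1 + u²/4)`) and (6.5) with `|s − w|² = (σ + ½)² + (t − u)²`:
`(1/2π)|∫ G(−½ + iu) du| ≤ D((8.21 + log q + log(3/2))/3 + (log 2)/3 + (1/6) log(1 + t²))`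
(`KhaleL65.integral_left_bound`; we use `log(1 + u²/4) ≤ log(9/4) + log(1 + u²/9)` to reuse Ford's
evaluated integral `FordL45.integral_log_div_le`, which costs `log(3/2)/3 = 0.135` against the
printed slack `3.44 − 2.97`);
(v) at each finite height the zero sum is split into the near zeros, the far non-trivial zeros
(`|F₀(s − ρ)| ≤ D/|s − ρ|² ≤ D/|1 + it − ρ|²` as `Re s ≥ 1 > Re ρ`) and `ρ = 0`
(`KhaleL65.nearSum_sub_le_re_zeroSum`), so that no convergence of `Σ_ρ F₀(s − ρ)` is needed
(exactly as in `FordL45.nearSum_sub_le_re_zeroSum`).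

The imprimitive case of Lemma 6.5 (the terms `I(χ)(f(0) + max f)Q(q)`, via Corollary A.2) and the
principal case (`δ(χ) = 1`: Ford's Lemma 4.5 itself, `FordL45.re_fordK_le`) are not restated here.

## Main statements

* `khaleK χ f s` — `K_χ(s) = Σ Λ(n) χ(n) f(log n) n^{−s}` [Khale2024, Lemma 6.5].
* `khaleIntegrand χ f s w` — `G(w) = (−L'/L)(w, χ) F₀(s − w)` [Khale2024, Lemma 6.5 (proof)].
* `KhaleFarZeroSumLT χ t r S` — "`Σ_{|1+it−ρ|>r} m(ρ)/|1+it−ρ|² ≤ S`" over the non-trivial zeros.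
* `KhaleL65.integral_LSeries_twist_mul_laplace` — Ford's (4.6) for `χ`.
* `KhaleL65.contour_identity` — (6.6) at finite height.
* `KhaleL65.re_khaleK_le`, `KhaleL65.re_khaleK_le'` — **Lemma 6.5, primitive case, real part**.

## References

* T. Khale, arXiv:2210.06457v1, Lemma 6.5 and its proof, (6.5)–(6.6), pp. 15–16. [Khale2024]
* K. Ford, *Zero-free regions for the Riemann zeta function*, Number Theory for the Millennium II
  (2002), Lemma 4.5, (4.5)–(4.7). [Ford2002Millennium]
* H. L. Montgomery, R. C. Vaughan, *Multiplicative Number Theory I*, CUP 2007, Lemma 12.7,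
  Cor. 10.8. [MontgomeryVaughan2007]
-/

noncomputable section

open Complex Real MeasureTheory Set Filter Topology
open scoped LSeries.notation ArithmeticFunction.vonMangoldt

namespace Literature.NumberTheory.LFunctions

variable {q : ℕ} [NeZero q]

/-! ### Definitions -/

/-- **`K_χ(s) = Σ_{n ≥ 1} Λ(n) χ(n) n^{−s} f(log n)`**, the smoothed twisted prime sum of Khale's
Lemma 6.5 (a finite sum when `f` has compact support; `K_{χ₀ mod 1} = fordK`).
[cite: Khale2024, Lemma 6.5] -/
def khaleK (χ : DirichletCharacter ℂ q) (f : ℝ → ℝ) (s : ℂ) : ℂ :=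
  ∑' n : ℕ, ((Λ n : ℝ) : ℂ) * χ (n : ZMod q) * (f (Real.log n) : ℂ) * (n : ℂ) ^ (-s)

/-- The contour integrand `G(w) = G_{χ,f,s}(w) = (−L'/L)(w, χ) · F₀(s − w)` of the proof of Lemma 6.5
("`I = (1/2πi) ∫ −L'(w, χ)/L(w, χ) F₀(s − w) dw`"). [cite: Khale2024, Lemma 6.5 (proof)] -/
def khaleIntegrand (χ : DirichletCharacter ℂ q) (f : ℝ → ℝ) (s w : ℂ) : ℂ :=
  -(deriv χ.LFunction w / χ.LFunction w) * fordLaplace₀ f (s - w)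

/-- "`Σ_{|1+it−ρ| > r} m(ρ)/|1 + it − ρ|² ≤ S`" over the non-trivial zeros `ρ` (`0 < Re ρ < 1`) of
`L(s, χ)` strictly outside the disc of radius `r` about `1 + it`, with multiplicity
`m = DirichletDisc.zeroOrder χ`, stated junk-free: every finite partial sum is `≤ S` (the quantity
bounded in Khale's Lemma 6.4; compare `FordFarZeroSumLT` for `ζ`). [cite: Khale2024, Lemma 6.4] -/
def KhaleFarZeroSumLT (χ : DirichletCharacter ℂ q) (t r S : ℝ) : Prop :=
  ∀ T : Finset ℂ, (∀ ρ ∈ T, χ.LFunction ρ = 0 ∧ 0 < ρ.re ∧ ρ.re < 1 ∧ r < ‖1 + t * I - ρ‖) →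
    ∑ ρ ∈ T, (DirichletDisc.zeroOrder χ ρ : ℝ) / ‖1 + t * I - ρ‖ ^ 2 ≤ S

/-- `KhaleFarZeroSumLT` is monotone in the bound. [folklore] -/
theorem KhaleFarZeroSumLT.mono {χ : DirichletCharacter ℂ q} {t r S S' : ℝ}
    (h : KhaleFarZeroSumLT χ t r S) (hS : S ≤ S') : KhaleFarZeroSumLT χ t r S' :=
  fun T hT ↦ (h T hT).trans hS

namespace KhaleL65

open FordL45 DirichletDisc

variable {χ : DirichletCharacter ℂ q}

/-! ### Primitive characters modulo `q ≥ 3` -/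

omit [NeZero q] in
/-- `3 ≤ q → 1 < q`. [folklore] -/
theorem one_lt_of_three_le (hq : 3 ≤ q) : 1 < q := by omega

/-- A primitive character modulo `q ≥ 3` is not principal. [folklore] -/
theorem ne_one (hprim : χ.IsPrimitive) (hq : 3 ≤ q) : χ ≠ 1 :=
  ExplicitPsiChar.ne_one_of_isPrimitive hprim (one_lt_of_three_le hq)

/-! ### The zeros of `L(·, χ)` in the rectangle `(−1/2, ∞) × (−T, T)` -/

/-- For `χ ≠ χ₀` the zeros of `L(·, χ)` with `Re ρ > −1/2` and `|Im ρ| < T` form a finite set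
(they lie in the disc `|ρ| ≤ |T| + 1` since `Re ρ < 1`). [folklore] -/
theorem rectZeroSet_finite (hχ : χ ≠ 1) (T : ℝ) :
    {ρ : ℂ | χ.LFunction ρ = 0 ∧ -(1 / 2 : ℝ) < ρ.re ∧ |ρ.im| < T}.Finite := by
  refine (DirichletDetector.finite_zeros_closedBall hχ 0 (|T| + 1)).subset ?_
  rintro ρ ⟨h0, hre, him⟩
  refine ⟨?_, h0⟩
  have hre1 : ρ.re < 1 := DirichletDetector.re_lt_one_of_LFunction_eq_zero hχ h0
  rw [Metric.mem_closedBall, dist_zero_right]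
  have h1 : |ρ.re| ≤ 1 := abs_le.2 ⟨by linarith, hre1.le⟩
  have h2 : |ρ.im| ≤ |T| := him.le.trans (le_abs_self T)
  linarith [Complex.norm_le_abs_re_add_abs_im ρ]

/-- The zeros `ρ` of `L(·, χ)` with `Re ρ > −1/2` and `|Im ρ| < T`, each listed once (a finite set
for `χ ≠ χ₀`; `∅` by convention otherwise): the poles of `G` inside `[−1/2, α] × [−T, T]`.
[cite: Khale2024, Lemma 6.5 (proof, (6.6))] -/
def rectZeros (χ : DirichletCharacter ℂ q) (T : ℝ) : Finset ℂ :=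
  open Classical in
  if h : {ρ : ℂ | χ.LFunction ρ = 0 ∧ -(1 / 2 : ℝ) < ρ.re ∧ |ρ.im| < T}.Finite then h.toFinset else ∅

/-- Membership in `rectZeros` (`χ ≠ χ₀`). [folklore] -/
theorem mem_rectZeros (hχ : χ ≠ 1) {T : ℝ} {ρ : ℂ} :
    ρ ∈ rectZeros χ T ↔ χ.LFunction ρ = 0 ∧ -(1 / 2 : ℝ) < ρ.re ∧ |ρ.im| < T := by
  rw [rectZeros, dif_pos (rectZeroSet_finite hχ T), Set.Finite.mem_toFinset, Set.mem_setOf_eq]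

/-- **The zeros of the rectangle for a primitive character**: a zero `ρ` of `L(·, χ)` with
`Re ρ ≥ −1/2` is either the trivial zero `0` (then `χ` is even and `m(0) = 1`) or a non-trivial
zero, `0 < Re ρ < 1`. [cite: MontgomeryVaughan2007, Corollary 10.8] -/
theorem zero_dichotomy (hprim : χ.IsPrimitive) (hq : 3 ≤ q) {ρ : ℂ} (h0 : χ.LFunction ρ = 0)
    (hre : -(1 / 2 : ℝ) ≤ ρ.re) :
    (ρ = 0 ∧ DirichletDisc.zeroOrder χ 0 = 1) ∨ (0 < ρ.re ∧ ρ.re < 1) := by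
  have hq1 := one_lt_of_three_le hq
  have hχ := ne_one hprim hq
  rcases ExplicitPsiChar.zero_eq_zero_or_mem_box hprim hq1 (T := |ρ.im|) h0 hre le_rfl with h | h
  · left
    refine ⟨h, ?_⟩
    rcases χ.even_or_odd with he | ho
    · exact ExplicitPsiChar.zeroOrder_zero_of_even hprim hχ he
    · exact absurd (h ▸ h0) (ExplicitPsiChar.LFunction_zero_ne_zero_of_odd hprim hχ ho)
  · exact Or.inr ⟨h.2.1, h.2.2.1⟩

/-! ### The contour identity on `[−1/2, α] × [−T, T]`, `α < Re s` ((6.6) at finite height) -/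

/-- **The residues of `G(w) = (−L'/L)(w, χ) F₀(s − w)` in `K = [−1/2, α] × [−T, T]`** for a
primitive `χ` modulo `q ≥ 3`, `1 < α < Re s`, `α ≤ 3/2`, at a good height `T > 0` (no non-trivial
zero has ordinate `±T`): `L(·, χ)` is entire, `F₀(s − w)` is analytic on `K` (`s` lies to the
right of `K`), and the poles are the zeros `ρ ∈ rectZeros χ T` (the non-trivial zeros with
`|Im ρ| < T` and, for even `χ`, `ρ = 0`), residues `−m(ρ) F₀(s − ρ)`:
`∮_{∂K} G = −2πi Σ_{ρ ∈ rectZeros χ T} m(ρ) F₀(s − ρ)`.  Only continuity and compact support of `f`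
are used. [cite: Khale2024, Lemma 6.5 (proof, (6.6))] -/
theorem contour_identity (hprim : χ.IsPrimitive) (hq : 3 ≤ q) {f : ℝ → ℝ} {x₀ : ℝ}
    (hfc : Continuous f) (hx₀ : 0 ≤ x₀) (hf0 : ∀ u, x₀ ≤ u → f u = 0) {s : ℂ} {α : ℝ} (hα : 1 < α)
    (hαs : α < s.re) {T : ℝ} (hT0 : 0 < T)
    (hgood : ∀ ρ : ℂ, χ.LFunction ρ = 0 → 0 < ρ.re → ρ.re < 1 → ρ.im ≠ T ∧ ρ.im ≠ -T) :
    Literature.Analysis.Complex.rectBoundaryIntegral (khaleIntegrand χ f s) (-(1 / 2)) α (-T) T =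
      2 * π * I * (-∑ ρ ∈ rectZeros χ T,
        (DirichletDisc.zeroOrder χ ρ : ℂ) * fordLaplace₀ f (s - ρ)) := by
  classical
  have hχ := ne_one hprim hq
  have hab : (-(1 / 2) : ℝ) < α := by linarith
  have hcd : -T < T := by linarith
  have hLd : Differentiable ℂ χ.LFunction := DirichletCharacter.differentiable_LFunction hχ
  -- differentiability of `F₀(s − ·)` off `s`
  have hF₀d : ∀ w : ℂ, w ≠ s → DifferentiableAt ℂ (fun w ↦ fordLaplace₀ f (s - w)) w := fun w hw ↦
    (differentiableAt_fordLaplace₀ hfc hx₀ hf0 (sub_ne_zero.2 (Ne.symm hw))).comp w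
      ((differentiableAt_const _).sub differentiableAt_id)
  -- the poles
  set S : Finset ℂ := rectZeros χ T with hS
  have hS_prop : ∀ ρ ∈ S, χ.LFunction ρ = 0 ∧ -(1 / 2 : ℝ) < ρ.re ∧ ρ.re < 1 ∧ -T < ρ.im ∧
      ρ.im < T ∧ ρ ≠ s := by
    intro ρ hρ
    obtain ⟨h0, hre, him⟩ := (mem_rectZeros hχ).1 hρ
    have hre1 : ρ.re < 1 := DirichletDetector.re_lt_one_of_LFunction_eq_zero hχ h0
    refine ⟨h0, hre, hre1, (abs_lt.1 him).1, (abs_lt.1 him).2, fun h ↦ ?_⟩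
    rw [h] at hre1
    linarith
  -- the residues
  set r : ℂ → ℂ := fun p ↦ -(DirichletDisc.zeroOrder χ p : ℂ) * fordLaplace₀ f (s - p) with hr
  -- the open set: a left half-plane not containing `s`
  set β : ℝ := (α + s.re) / 2 with hβ
  have hαβ : α < β := by rw [hβ]; linarith
  have hβs : β < s.re := by rw [hβ]; linarith
  set U : Set ℂ := ({w : ℂ | χ.LFunction w ≠ 0} ∪ (S : Set ℂ)) ∩ {w : ℂ | w.re < β} with hU
  have hUopen : IsOpen U := by
    refine IsOpen.inter ?_ (isOpen_lt Complex.continuous_re continuous_const)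
    rw [isOpen_iff_mem_nhds]
    intro w hw
    by_cases hLw : χ.LFunction w = 0
    · have hwS : w ∈ (S : Set ℂ) := by
        rcases hw with h | h
        · exact absurd hLw h
        · exact h
      rcases (hLd.analyticAt w).eventually_eq_zero_or_eventually_ne_zero with h | h
      · exact absurd (analyticOrderAt_eq_top.2 h) (analyticOrderAt_LFunction_ne_top χ hχ w)
      · rw [eventually_nhdsWithin_iff] at h
        filter_upwards [h] with z hz
        by_cases hzw : z = w
        · exact Or.inr (hzw ▸ hwS)
        · exact Or.inl (hz hzw)
    · exact mem_of_superset ((isOpen_ne_fun hLd.continuous continuous_const).mem_nhds hLw)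
        subset_union_left
  have hUs : ∀ w ∈ U, w ≠ s := by
    intro w hw h
    have := hw.2
    simp only [mem_setOf_eq] at this
    rw [h] at this
    linarith
  have hKU : Icc (-(1 / 2) : ℝ) α ×ℂ Icc (-T) T ⊆ U := by
    intro w hw
    have hwre := (Complex.mem_reProdIm.1 hw).1
    have hwim := (Complex.mem_reProdIm.1 hw).2
    refine ⟨?_, by simp only [mem_setOf_eq]; linarith [hwre.2]⟩
    by_cases hLw : χ.LFunction w = 0
    · right
      rw [Finset.mem_coe, hS, mem_rectZeros hχ]
      rcases zero_dichotomy hprim hq hLw hwre.1 with ⟨hw0, -⟩ | ⟨h0, h1⟩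
      · subst hw0
        exact ⟨hLw, by simp, by simpa [abs_lt] using hT0⟩
      · obtain ⟨hT1, hT2⟩ := hgood w hLw h0 h1
        refine ⟨hLw, by linarith, abs_lt.2 ⟨lt_of_le_of_ne hwim.1 (Ne.symm hT2),
          lt_of_le_of_ne hwim.2 hT1⟩⟩
    · exact Or.inl hLw
  have hSsub : (S : Set ℂ) ⊆ Ioo (-(1 / 2) : ℝ) α ×ℂ Ioo (-T) T := by
    intro p hp
    obtain ⟨-, hre, hre1, hi1, hi2, -⟩ := hS_prop p (Finset.mem_coe.1 hp)
    exact ⟨⟨hre, by linarith⟩, ⟨hi1, hi2⟩⟩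
  -- differentiability off the poles
  have hGd : DifferentiableOn ℂ (khaleIntegrand χ f s) (U \ (S : Set ℂ)) := by
    intro w hw
    have hLw : χ.LFunction w ≠ 0 := by
      rcases hw.1.1 with h | h
      · exact h
      · exact absurd h hw.2
    have hws : w ≠ s := hUs w hw.1
    exact ((((hLd.analyticAt w).deriv.differentiableAt).div (hLd w) hLw).neg.mul
      (hF₀d w hws)).differentiableWithinAt
  -- apply the residue theorem
  have key := Literature.Analysis.Complex.rectBoundaryIntegral_eq_sum_of_simplePoles hab hcd S
    (khaleIntegrand χ f s) r U hUopen hKU hSsub hGd ?poles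
  case poles =>
    intro p hp
    obtain ⟨hLp, -, -, -, -, hps⟩ := hS_prop p hp
    obtain ⟨B, hB, hev⟩ := exists_analyticAt_logDeriv_eq_add (hLd.analyticAt p)
      (analyticOrderAt_LFunction_ne_top χ hχ p)
    set m : ℕ := analyticOrderNatAt χ.LFunction p with hm
    have hmcast : (m : ℂ) = (DirichletDisc.zeroOrder χ p : ℂ) := by rw [hm, DirichletDisc.zeroOrder]
    have hall : ∀ᶠ z in 𝓝 p, (z ≠ p → χ.LFunction z ≠ 0 ∧
        deriv χ.LFunction z / χ.LFunction z = (m : ℂ) / (z - p) + B z) ∧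
        DifferentiableAt ℂ B z ∧ z ≠ s := by
      rw [eventually_nhdsWithin_iff] at hev
      filter_upwards [hev, hB.eventually_analyticAt, isOpen_ne.eventually_mem hps] with z h1 h2 h3
      exact ⟨h1, h2.differentiableAt, h3⟩
    obtain ⟨V, hVsub, hVopen, hpV⟩ := mem_nhds_iff.1 hall
    refine ⟨fun z ↦ (-B z) * fordLaplace₀ f (s - z) * (z - p) - (m : ℂ) * fordLaplace₀ f (s - z),
      V, hVopen.mem_nhds hpV, ?_, ?_, ?_⟩
    · intro z hz
      obtain ⟨-, hBd, hzs⟩ := hVsub hz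
      have hd2 := hF₀d z hzs
      exact (((hBd.neg.mul hd2).mul (differentiableAt_id.sub_const p)).sub
        ((differentiableAt_const _).mul hd2)).differentiableWithinAt
    · simp only [hr, sub_self, mul_zero, zero_sub, hmcast, neg_mul]
    · intro z hz hzp
      obtain ⟨h1, -, -⟩ := hVsub hz
      obtain ⟨-, hLz⟩ := h1 hzp
      rw [khaleIntegrand, hLz]
      have h3 : z - p ≠ 0 := sub_ne_zero.2 hzp
      field_simp
      ring
  rw [key, hr, ← Finset.sum_neg_distrib]
  congr 1
  refine Finset.sum_congr rfl fun ρ _ ↦ ?_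
  ring

/-! ### Standing facts: (4.6) for the twisted series -/

open LSeries in
/-- **Ford's (4.6) for `K_χ`** ("we may integrate term by term … `I = Σ_n Λ(n)χ(n) J_n` where
`J_n = n^{−s}(f(log n) − f(0))`"): for an admissible smoothing (`IsFordSmoothing f η D`, `η > 0`),
`F₀ = ℒ(f − f(0))`, `Re s > 1` and `1 < α < Re s`,
`(1/2π) ∫ L(χΛ, α + iy) F₀(s − α − iy) dy = K_χ(s) + f(0) L'(s, χ)/L(s, χ)`
(`L(χΛ, ·) = −L'/L(·, χ)` on `Re > 1`).  The termwise step is Laplace inversion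
(`FordL45.laplace_inversion`). [cite: Khale2024, Lemma 6.5 (proof)] -/
theorem integral_LSeries_twist_mul_laplace (χ : DirichletCharacter ℂ q) {f : ℝ → ℝ} {η D : ℝ}
    (hf : IsFordSmoothing f η D) (hη : 0 < η) {s : ℂ} {α : ℝ} (hα : 1 < α) (hαs : α < s.re) :
    ((1 / (2 * π) : ℝ) : ℂ) * ∫ y : ℝ, LSeries (↗χ * ↗Λ) ((α : ℂ) + y * I) *
        fordLaplace (fun u ↦ f u - f 0) (s - ((α : ℂ) + y * I)) =
      khaleK χ f s + (f 0 : ℂ) * (deriv χ.LFunction s / χ.LFunction s) := by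
  -- notation and basic facts
  set g : ℝ → ℝ := fun u ↦ f u - f 0 with hg
  set F₀ : ℂ → ℂ := fordLaplace g with hF₀
  set c : ℝ := s.re - α with hc
  set t : ℝ := s.im with ht
  have hc0 : 0 < c := by rw [hc]; linarith
  have hs1 : 1 < s.re := hα.trans hαs
  have hfc : Continuous f := hf.contDiff.continuous
  obtain ⟨x₀, M, -, -, hM⟩ := hf.exists_support_bound
  have hgc : Continuous g := hfc.sub continuous_const
  have hgM : ∀ u, 0 < u → |g u| ≤ 2 * M := by
    intro u hu
    calc |g u| = |f u - f 0| := rfl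
      _ ≤ |f u| + |f 0| := abs_sub _ _
      _ ≤ M + M := add_le_add (hM u hu.le) (hM 0 le_rfl)
      _ = 2 * M := by ring
  have hV : Complex.VerticalIntegrable F₀ c := verticalIntegrable_fordLaplace_sub hf hη hc0
  -- `s - (α + iy) = c + (t - y) i`
  have hsw : ∀ y : ℝ, s - ((α : ℂ) + y * I) = (c : ℂ) + ((t - y : ℝ) : ℂ) * I := fun y ↦ by
    apply Complex.ext <;> simp [hc, ht]
  -- the coefficients
  set a₀ : ℕ → ℂ := ↗χ * ↗Λ with ha₀
  have ha₀0 : a₀ 0 = 0 := by simp [ha₀]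
  have ha₀_apply : ∀ n, a₀ n = χ (n : ZMod q) * ((Λ n : ℝ) : ℂ) := fun n ↦ by simp [ha₀]
  have ha₀_norm : ∀ n, ‖a₀ n‖ ≤ ‖((Λ n : ℝ) : ℂ)‖ := fun n ↦ by
    rw [ha₀_apply, norm_mul]
    calc ‖χ (n : ZMod q)‖ * ‖((Λ n : ℝ) : ℂ)‖ ≤ 1 * ‖((Λ n : ℝ) : ℂ)‖ :=
          mul_le_mul_of_nonneg_right (DirichletCharacter.norm_le_one χ _) (norm_nonneg _)
      _ = _ := one_mul _
  -- the terms
  set a : ℕ → ℝ → ℂ := fun n y ↦ term a₀ ((α : ℂ) + y * I) n * F₀ (s - ((α : ℂ) + y * I)) with ha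
  have hterm_norm : ∀ (n : ℕ) (y : ℝ), ‖term a₀ ((α : ℂ) + y * I) n‖ = ‖term a₀ (α : ℂ) n‖ := by
    intro n y
    rw [norm_term_eq, norm_term_eq]
    simp
  have hsumα : Summable fun n ↦ ‖term a₀ (α : ℂ) n‖ :=
    (DirichletCharacter.LSeriesSummable_twist_vonMangoldt χ (s := (α : ℂ)) (by simpa using hα)).norm
  -- integrability of each term and the summability of the integrals of norms
  have hFint : Integrable fun y : ℝ ↦ F₀ (s - ((α : ℂ) + y * I)) := by
    have h := (hV.comp_sub_left t)
    refine h.congr (ae_of_all _ fun y ↦ ?_)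
    simp only
    rw [hsw y]
  have hterm_cont : ∀ n, Continuous fun y : ℝ ↦ term a₀ ((α : ℂ) + y * I) n := by
    intro n
    rcases Nat.eq_zero_or_pos n with hn | hn
    · subst hn; simp [term_zero]; exact continuous_const
    · have hne : n ≠ 0 := Nat.pos_iff_ne_zero.1 hn
      simp only [term_of_ne_zero hne]
      refine continuous_const.div (Continuous.const_cpow (by fun_prop) (Or.inl ?_)) fun y ↦ ?_
      · exact_mod_cast hne
      · exact cpow_ne_zero_iff_of_exponent_ne_zero (by
          intro h; have := congrArg Complex.re h; simp at this; linarith) |>.2 (by exact_mod_cast hne)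
  have ha_int : ∀ n, Integrable (a n) := fun n ↦ by
    refine (hFint.const_mul (‖term a₀ (α : ℂ) n‖ : ℂ)).norm.mono' ?_ (ae_of_all _ fun y ↦ ?_)
    · exact ((hterm_cont n).aestronglyMeasurable).mul hFint.aestronglyMeasurable
    · simp only [ha, norm_mul, hterm_norm, Complex.norm_real, Real.norm_eq_abs, abs_norm]
      rfl
  -- `Σ_n ∫ ‖a n‖ < ∞`
  set V : ℝ := ∫ y : ℝ, ‖F₀ (s - ((α : ℂ) + y * I))‖ with hV'
  have ha_norm : ∀ n, ∫ y, ‖a n y‖ = ‖term a₀ (α : ℂ) n‖ * V := by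
    intro n
    have : (fun y : ℝ ↦ ‖a n y‖) = fun y : ℝ ↦ ‖term a₀ (α : ℂ) n‖ * ‖F₀ (s - ((α : ℂ) + y * I))‖ := by
      funext y; simp only [ha, norm_mul, hterm_norm]
    rw [this, MeasureTheory.integral_const_mul]
  have hsum_int : Summable fun n ↦ ∫ y, ‖a n y‖ := by
    simp_rw [ha_norm]; exact hsumα.mul_right V
  -- interchange of sum and integral
  have hswap := integral_tsum_of_summable_integral_norm ha_int hsum_int
  have hpt : ∀ y : ℝ, ∑' n, a n y = LSeries a₀ ((α : ℂ) + y * I) * F₀ (s - ((α : ℂ) + y * I)) := by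
    intro y; simp only [ha]; rw [tsum_mul_right]; rfl
  have hI : ∫ y : ℝ, LSeries a₀ ((α : ℂ) + y * I) * F₀ (s - ((α : ℂ) + y * I)) = ∑' n, ∫ y, a n y := by
    rw [hswap]; exact integral_congr_ae (ae_of_all _ fun y ↦ (hpt y).symm)
  -- each `∫ a n = 2π a₀(n) n^{-s} g(log n)` (Laplace inversion for `n ≥ 2`; `a₀ 0 = a₀ 1 = 0`)
  have hJ : ∀ n : ℕ, ∫ y, a n y = (2 * π : ℂ) * (a₀ n * (n : ℂ) ^ (-s) * (g (Real.log n) : ℂ)) := by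
    intro n
    rcases Nat.lt_or_ge n 2 with hn | hn
    · interval_cases n
      · simp [ha, ha₀0]
      · simp [ha, ha₀_apply, ArithmeticFunction.vonMangoldt_apply_one]
    · have hn0 : (n : ℂ) ≠ 0 := by exact_mod_cast (show n ≠ 0 by omega)
      have h1 : ∀ y : ℝ, a n y = a₀ n * (n : ℂ) ^ (-s) *
          ((fun y' : ℝ ↦ (n : ℂ) ^ ((c : ℂ) + y' * I) * F₀ ((c : ℂ) + y' * I)) (t - y)) := by
        intro y
        simp only [ha, term_of_ne_zero (show n ≠ 0 by omega), hsw y]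
        have hexp : -((α : ℂ) + y * I) = -s + ((c : ℂ) + ((t - y : ℝ) : ℂ) * I) := by
          apply Complex.ext <;> simp [hc, ht] <;> ring
        rw [div_eq_mul_inv, ← Complex.cpow_neg, hexp, Complex.cpow_add _ _ hn0]
        ring
      simp_rw [h1]
      rw [MeasureTheory.integral_const_mul,
        integral_sub_left_eq_self (fun y' : ℝ ↦ (n : ℂ) ^ ((c : ℂ) + y' * I) * F₀ ((c : ℂ) + y' * I)) volume t]
      have hinv := laplace_inversion hgc hgM hc0 hV (x := n) (by exact_mod_cast hn)
      rw [← hF₀, Complex.ofReal_natCast] at hinv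
      have hint_eq : ∫ y' : ℝ, (n : ℂ) ^ ((c : ℂ) + y' * I) * F₀ ((c : ℂ) + y' * I) =
          (2 * π : ℂ) * (g (Real.log n) : ℂ) := by
        rw [← hinv, ← mul_assoc]
        have h2 : (2 * π : ℂ) * (((1 / (2 * π) : ℝ)) : ℂ) = 1 := by
          push_cast; field_simp
        rw [h2, one_mul]
      rw [hint_eq]; ring
  rw [hI]
  simp_rw [hJ]
  rw [tsum_mul_left, ← mul_assoc]
  have h2 : (((1 / (2 * π) : ℝ)) : ℂ) * (2 * π : ℂ) = 1 := by push_cast; field_simp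
  rw [h2, one_mul]
  -- the two Dirichlet series
  have hsumL : Summable fun n : ℕ ↦ a₀ n * (n : ℂ) ^ (-s) := by
    have h := (DirichletCharacter.LSeriesSummable_twist_vonMangoldt χ hs1)
    rw [LSeriesSummable] at h
    refine h.congr fun n ↦ ?_
    rw [term_def₀ ha₀0]
  have hLs : LSeries a₀ s = ∑' n : ℕ, a₀ n * (n : ℂ) ^ (-s) := by
    rw [LSeries]; exact tsum_congr fun n ↦ by rw [term_def₀ ha₀0]
  have hsumK : Summable fun n : ℕ ↦ a₀ n * (n : ℂ) ^ (-s) * (f (Real.log n) : ℂ) := by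
    refine Summable.of_norm_bounded (g := fun n ↦ ‖a₀ n * (n : ℂ) ^ (-s)‖ * M)
      (hsumL.norm.mul_right M) fun n ↦ ?_
    rw [norm_mul, Complex.norm_real, Real.norm_eq_abs]
    exact mul_le_mul_of_nonneg_left (hM _ (Real.log_natCast_nonneg n)) (norm_nonneg _)
  have hK : khaleK χ f s = ∑' n : ℕ, a₀ n * (n : ℂ) ^ (-s) * (f (Real.log n) : ℂ) := by
    rw [khaleK]; exact tsum_congr fun n ↦ by rw [ha₀_apply]; ring
  have hg' : ∀ n : ℕ, a₀ n * (n : ℂ) ^ (-s) * (g (Real.log n) : ℂ) =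
      a₀ n * (n : ℂ) ^ (-s) * (f (Real.log n) : ℂ) - (f 0 : ℂ) * (a₀ n * (n : ℂ) ^ (-s)) := by
    intro n; simp only [hg]; push_cast; ring
  simp_rw [hg']
  rw [hsumK.tsum_sub (hsumL.mul_left _), tsum_mul_left, ← hK, ← hLs, ha₀,
    ← DirichletZFR.neg_logDeriv_LFunction_eq χ hs1]
  ring

/-! ### The right edge: `∫ G(α + iy) dy = 2π (K_χ(s) + f(0) L'/L(s, χ))` -/

/-- On `Re w = α > 1`: `G(α + iy) = L(χΛ, α + iy) · F₀(s − α − iy)`. [folklore] -/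
theorem khaleIntegrand_right (χ : DirichletCharacter ℂ q) {f : ℝ → ℝ} {s : ℂ} {α : ℝ} (hα : 1 < α)
    (y : ℝ) :
    khaleIntegrand χ f s ((α : ℂ) + y * I) =
      LSeries (↗χ * ↗Λ) ((α : ℂ) + y * I) * fordLaplace₀ f (s - ((α : ℂ) + y * I)) := by
  rw [khaleIntegrand, DirichletZFR.neg_logDeriv_LFunction_eq χ (by simp; linarith)]

/-- **The right edge, whole line**: for `χ ≠ χ₀`, `1 < α < Re s`, `y ↦ G(α + iy)` is integrable and
`∫ G(α + iy) dy = 2π (K_χ(s) + f(0) L'(s, χ)/L(s, χ))`. [cite: Khale2024, Lemma 6.5 (proof)] -/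
theorem integral_right_eq (hχ : χ ≠ 1) {f : ℝ → ℝ} {η D : ℝ} (hf : IsFordSmoothing f η D)
    (hη : 0 < η) {s : ℂ} {α : ℝ} (hα : 1 < α) (hαs : α < s.re) :
    Integrable (fun y : ℝ ↦ khaleIntegrand χ f s ((α : ℂ) + y * I)) ∧
    ∫ y : ℝ, khaleIntegrand χ f s ((α : ℂ) + y * I) =
      2 * π * (khaleK χ f s + (f 0 : ℂ) * (deriv χ.LFunction s / χ.LFunction s)) := by
  set g : ℝ → ℝ := fun u ↦ f u - f 0 with hg
  have hLd : Differentiable ℂ χ.LFunction := DirichletCharacter.differentiable_LFunction hχ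
  have hre : ∀ y : ℝ, 0 < (s - ((α : ℂ) + y * I)).re := fun y ↦ by simp; linarith
  have heq : ∀ y : ℝ, khaleIntegrand χ f s ((α : ℂ) + y * I) =
      LSeries (↗χ * ↗Λ) ((α : ℂ) + y * I) * fordLaplace g (s - ((α : ℂ) + y * I)) := fun y ↦ by
    rw [khaleIntegrand_right χ hα, fordLaplace₀_eq_fordLaplace_sub hf (hre y)]
  -- integrability
  have hV : Complex.VerticalIntegrable (fordLaplace g) (s.re - α) :=
    verticalIntegrable_fordLaplace_sub hf hη (by linarith)
  have hFint : Integrable fun y : ℝ ↦ fordLaplace g (s - ((α : ℂ) + y * I)) := by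
    have h := hV.comp_sub_left s.im
    refine h.congr (ae_of_all _ fun y ↦ ?_)
    simp only
    congr 1
    apply Complex.ext <;> simp
  -- continuity of `G` on the line
  have hGcont : Continuous fun y : ℝ ↦ khaleIntegrand χ f s ((α : ℂ) + y * I) := by
    obtain ⟨x₀, M, hx₀, hf0, -⟩ := hf.exists_support_bound
    have hfc := hf.contDiff.continuous
    refine continuous_iff_continuousAt.2 fun y ↦ ?_
    set w : ℂ := (α : ℂ) + y * I with hw
    have hL : χ.LFunction w ≠ 0 :=
      DirichletCharacter.LFunction_ne_zero_of_one_le_re χ (Or.inl hχ) (by simp [hw]; linarith)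
    have hws : s - w ≠ 0 := by
      rw [sub_ne_zero]; intro h; have := congrArg Complex.re h; simp [hw] at this; linarith
    have han := hLd.analyticAt w
    have hG : ContinuousAt (khaleIntegrand χ f s) w := by
      refine ((han.deriv.continuousAt.div han.continuousAt hL).neg.mul ?_)
      exact ((differentiableAt_fordLaplace₀ hfc hx₀ hf0 hws).continuousAt.comp
        (continuousAt_const.sub continuousAt_id))
    exact ContinuousAt.comp (f := fun y : ℝ ↦ (α : ℂ) + y * I) hG (Continuous.continuousAt (by fun_prop))
  have hGint : Integrable fun y : ℝ ↦ khaleIntegrand χ f s ((α : ℂ) + y * I) := by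
    refine (hFint.norm.const_mul (1 / (α - 1))).mono' hGcont.aestronglyMeasurable
      (ae_of_all _ fun y ↦ ?_)
    rw [khaleIntegrand, norm_mul, norm_neg, fordLaplace₀_eq_fordLaplace_sub hf (hre y)]
    have h := KhaleL41.norm_logDeriv_LFunction_lt χ (s := (α : ℂ) + y * I) (by simp; linarith)
    simp only [add_re, ofReal_re, mul_re, I_re, mul_zero, ofReal_im, I_im, mul_one, sub_self,
      add_zero] at h
    exact mul_le_mul_of_nonneg_right h.le (norm_nonneg _)
  refine ⟨hGint, ?_⟩
  have h46 := integral_LSeries_twist_mul_laplace χ hf hη hα hαs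
  rw [integral_congr_ae (ae_of_all _ heq)]
  rw [← h46, ← mul_assoc]
  have h2 : (2 * π : ℂ) * (((1 / (2 * π) : ℝ)) : ℂ) = 1 := by push_cast; field_simp
  rw [h2, one_mul]

/-! ### The left edge: Lemma 4.2 and (6.5) -/

/-- `log(1 + y²/4) ≤ log(9/4) + log(1 + y²/9)` (`1 + y²/4 ≤ (9/4)(1 + y²/9)`). [folklore] -/
theorem log_quarter_le (y : ℝ) :
    Real.log (1 + y ^ 2 / 4) ≤ 2 * Real.log (3 / 2) + Real.log (1 + y ^ 2 / 9) := by
  rw [show 2 * Real.log (3 / 2) = Real.log ((3 / 2) ^ 2) by rw [Real.log_pow]; norm_num,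
    ← Real.log_mul (by norm_num) (by positivity)]
  exact Real.log_le_log (by positivity) (by nlinarith [sq_nonneg y])

/-- **The error integral of the left line.** For `a ≥ 0`, `c ≥ 3/2` and real `t`:
`∫ (a + ½ log(1 + v²/4))/(c² + (t − v)²) dv ≤ 2π(a + log(3/2))/3 + ⅓(π log(1 + t²) + 2π log 2)`
(Khale: "`I' ≤ (2π/3) log q + 5.48π + ⅓∫ log(1 + (t/2 + 3v/4)²)/(1+v²) dv ≤ …`"; here through
`FordL45.integral_log_div_le` after `log_quarter_le`). [cite: Khale2024, Lemma 6.5 (proof)] -/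
theorem error_integral_le {a c : ℝ} (ha : 0 ≤ a) (hc : 3 / 2 ≤ c) (t : ℝ) :
    ∫ v : ℝ, (a + 1 / 2 * Real.log (1 + v ^ 2 / 4)) / (c ^ 2 + (t - v) ^ 2) ≤
      2 * π * ((a + Real.log (3 / 2)) / 3) + 1 / 3 * (π * Real.log (1 + t ^ 2) + 2 * π * Real.log 2) := by
  have hl32 : 0 ≤ Real.log (3 / 2) := Real.log_nonneg (by norm_num)
  set a' : ℝ := a + Real.log (3 / 2) with ha'
  have ha'0 : 0 ≤ a' := by positivity
  have hI1 : Integrable fun v : ℝ ↦ 1 / ((3 / 2 : ℝ) ^ 2 + (t - v) ^ 2) :=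
    FordL45.integrable_inv_sq_add_sq (by norm_num) t
  have hI2 := FordL45.integrable_log_div t
  have hψ : Integrable fun v : ℝ ↦ a' * (1 / ((3 / 2 : ℝ) ^ 2 + (t - v) ^ 2)) +
      1 / 2 * (Real.log (1 + v ^ 2 / 9) / (9 / 4 + (t - v) ^ 2)) := (hI1.const_mul _).add (hI2.const_mul _)
  have hle : ∀ v : ℝ, (a + 1 / 2 * Real.log (1 + v ^ 2 / 4)) / (c ^ 2 + (t - v) ^ 2) ≤
      a' * (1 / ((3 / 2 : ℝ) ^ 2 + (t - v) ^ 2)) + 1 / 2 * (Real.log (1 + v ^ 2 / 9) / (9 / 4 + (t - v) ^ 2)) := by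
    intro v
    have hv4 : 0 ≤ Real.log (1 + v ^ 2 / 4) := Real.log_nonneg (by nlinarith)
    have hv9 : 0 ≤ Real.log (1 + v ^ 2 / 9) := Real.log_nonneg (by nlinarith)
    have hq := log_quarter_le v
    have hnum : 0 ≤ a + 1 / 2 * Real.log (1 + v ^ 2 / 4) := by positivity
    have hnum' : a + 1 / 2 * Real.log (1 + v ^ 2 / 4) ≤ a' + 1 / 2 * Real.log (1 + v ^ 2 / 9) := by
      rw [ha']; linarith
    have hden : 0 < 9 / 4 + (t - v) ^ 2 := by positivity
    have hc2 : 9 / 4 + (t - v) ^ 2 ≤ c ^ 2 + (t - v) ^ 2 := by nlinarith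
    calc (a + 1 / 2 * Real.log (1 + v ^ 2 / 4)) / (c ^ 2 + (t - v) ^ 2)
        ≤ (a + 1 / 2 * Real.log (1 + v ^ 2 / 4)) / (9 / 4 + (t - v) ^ 2) :=
          div_le_div_of_nonneg_left hnum hden hc2
      _ ≤ (a' + 1 / 2 * Real.log (1 + v ^ 2 / 9)) / (9 / 4 + (t - v) ^ 2) :=
          div_le_div_of_nonneg_right hnum' hden.le
      _ = _ := by norm_num; ring
  have hRHS : ∫ v : ℝ, (a' * (1 / ((3 / 2 : ℝ) ^ 2 + (t - v) ^ 2)) +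
      1 / 2 * (Real.log (1 + v ^ 2 / 9) / (9 / 4 + (t - v) ^ 2))) ≤
      2 * π * (a' / 3) + 1 / 3 * (π * Real.log (1 + t ^ 2) + 2 * π * Real.log 2) := by
    rw [integral_add (hI1.const_mul _) (hI2.const_mul _), MeasureTheory.integral_const_mul,
      MeasureTheory.integral_const_mul, FordL45.integral_inv_sq_add_sq (by norm_num : (0 : ℝ) < 3 / 2)]
    have := FordL45.integral_log_div_le t
    have e : a' * (π / (3 / 2)) = 2 * π * (a' / 3) := by ring
    nlinarith [Real.pi_pos]
  by_cases hφ : Integrable fun v : ℝ ↦ (a + 1 / 2 * Real.log (1 + v ^ 2 / 4)) / (c ^ 2 + (t - v) ^ 2)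
  · exact (integral_mono hφ hψ hle).trans hRHS
  · rw [integral_undef hφ]
    have h2 := Real.log_two_gt_d9
    have : 0 ≤ Real.log (1 + t ^ 2) := Real.log_nonneg (by nlinarith)
    nlinarith [Real.pi_gt_three]

/-- **The left edge, whole line**: for `χ` primitive modulo `q ≥ 3`, an admissible smoothing,
`0 < η ≤ 1/2` and `Re s ≥ 1`, `y ↦ G(−1/2 + iy)` is integrable and
`‖∫ G(−1/2 + iy) dy‖ ≤ D ∫ (8.21 + log q + ½ log(1 + y²/4))/((σ + ½)² + (t − y)²) dy`
(Lemma 4.2 for `L'/L` on the line, (6.5) for `F₀(s − w)`, `|s − w|² = (σ + ½)² + (t − y)²`).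
[cite: Khale2024, Lemma 6.5 (proof)] -/
theorem norm_integral_left_le (hprim : χ.IsPrimitive) (hq : 3 ≤ q) {f : ℝ → ℝ} {η D : ℝ}
    (hf : IsFordSmoothing f η D) (hη : 0 < η) (hη2 : η ≤ 1 / 2) {s : ℂ} (hs1 : 1 ≤ s.re) :
    Integrable (fun y : ℝ ↦ khaleIntegrand χ f s (((-(1 / 2) : ℝ) : ℂ) + y * I)) ∧
    ‖∫ y : ℝ, khaleIntegrand χ f s (((-(1 / 2) : ℝ) : ℂ) + y * I)‖ ≤
      D * ∫ y : ℝ, (8.21 + Real.log q + 1 / 2 * Real.log (1 + y ^ 2 / 4)) /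
        ((s.re + 1 / 2) ^ 2 + (s.im - y) ^ 2) := by
  have hχ := ne_one hprim hq
  have hLd : Differentiable ℂ χ.LFunction := DirichletCharacter.differentiable_LFunction hχ
  obtain ⟨x₀, M, hx₀, hf0, -⟩ := hf.exists_support_bound
  have hfc := hf.contDiff.continuous
  have hD0 := hf.D_nonneg (by linarith)
  have hq1 : (1 : ℝ) ≤ q := by exact_mod_cast NeZero.one_le
  have hlogq : 0 ≤ Real.log q := Real.log_nonneg hq1
  set σ := s.re with hσ
  set t := s.im with ht
  set c : ℝ := σ + 1 / 2 with hc
  have hc32 : 3 / 2 ≤ c := by rw [hc]; linarith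
  -- pointwise bound
  have hsw : ∀ y : ℝ, s - (((-(1 / 2) : ℝ) : ℂ) + y * I) = (c : ℂ) + ((t - y : ℝ) : ℂ) * I := fun y ↦ by
    apply Complex.ext <;> simp [hc, hσ, ht]
  have hnorm_sw : ∀ y : ℝ, ‖(c : ℂ) + ((t - y : ℝ) : ℂ) * I‖ ^ 2 = c ^ 2 + (t - y) ^ 2 := fun y ↦ by
    rw [Complex.sq_norm, Complex.normSq_apply]; simp; ring
  have hbound : ∀ y : ℝ, ‖khaleIntegrand χ f s (((-(1 / 2) : ℝ) : ℂ) + y * I)‖ ≤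
      D * ((8.21 + Real.log q + 1 / 2 * Real.log (1 + y ^ 2 / 4)) / (c ^ 2 + (t - y) ^ 2)) := by
    intro y
    rw [khaleIntegrand, norm_mul, norm_neg, hsw y]
    have h1 := KhaleL42.norm_deriv_div_LFunction_left_le hprim hq y
    have hcy : c ≤ ‖(c : ℂ) + ((t - y : ℝ) : ℂ) * I‖ := by
      have := Complex.abs_re_le_norm ((c : ℂ) + ((t - y : ℝ) : ℂ) * I)
      simp only [add_re, ofReal_re, mul_re, I_re, mul_zero, ofReal_im, I_im, mul_one, sub_self,
        add_zero] at this
      rw [abs_of_pos (show (0 : ℝ) < c by linarith)] at this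
      exact this
    have h2 := hf.laplace_bound ((c : ℂ) + ((t - y : ℝ) : ℂ) * I) (by simp; linarith)
      (by linarith)
    rw [fordLaplace₀]
    rw [hnorm_sw y] at h2
    have hnum : 0 ≤ 8.21 + Real.log q + 1 / 2 * Real.log (1 + y ^ 2 / 4) := by
      have : 0 ≤ Real.log (1 + y ^ 2 / 4) := Real.log_nonneg (by nlinarith)
      positivity
    calc ‖deriv χ.LFunction (((-(1 / 2) : ℝ) : ℂ) + y * I) / χ.LFunction (((-(1 / 2) : ℝ) : ℂ) + y * I)‖ *
          ‖fordLaplace f ((c : ℂ) + ((t - y : ℝ) : ℂ) * I) - (f 0 : ℂ) / ((c : ℂ) + ((t - y : ℝ) : ℂ) * I)‖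
        ≤ (8.21 + Real.log q + 1 / 2 * Real.log (1 + y ^ 2 / 4)) * (D / (c ^ 2 + (t - y) ^ 2)) :=
          mul_le_mul h1 h2 (norm_nonneg _) hnum
      _ = _ := by ring
  -- continuity on the line
  have hGcont : Continuous fun y : ℝ ↦ khaleIntegrand χ f s (((-(1 / 2) : ℝ) : ℂ) + y * I) := by
    refine continuous_iff_continuousAt.2 fun y ↦ ?_
    set w : ℂ := (((-(1 / 2) : ℝ) : ℂ) + y * I) with hw
    have hL : χ.LFunction w ≠ 0 := KhaleL42.LFunction_left_ne_zero hprim (le_trans (by norm_num) hq) y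
    have hws : s - w ≠ 0 := by
      rw [sub_ne_zero]; intro h; have := congrArg Complex.re h; simp [hw] at this; linarith
    have han := hLd.analyticAt w
    have hG : ContinuousAt (khaleIntegrand χ f s) w := by
      refine ((han.deriv.continuousAt.div han.continuousAt hL).neg.mul ?_)
      exact ((differentiableAt_fordLaplace₀ hfc hx₀ hf0 hws).continuousAt.comp
        (continuousAt_const.sub continuousAt_id))
    exact ContinuousAt.comp (f := fun y : ℝ ↦ (((-(1 / 2) : ℝ) : ℂ) + y * I)) hG
      (Continuous.continuousAt (by fun_prop))
  -- the majorant is integrable (compare with `c = 3/2`, `log(1 + y²/4) ≤ 2 log(3/2) + log(1 + y²/9)`)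
  set a' : ℝ := 8.21 + Real.log q + Real.log (3 / 2) with ha'
  have hl32 : 0 ≤ Real.log (3 / 2) := Real.log_nonneg (by norm_num)
  have hmaj : Integrable fun y : ℝ ↦
      D * ((8.21 + Real.log q + 1 / 2 * Real.log (1 + y ^ 2 / 4)) / (c ^ 2 + (t - y) ^ 2)) := by
    have hI1 : Integrable fun v : ℝ ↦ 1 / ((3 / 2 : ℝ) ^ 2 + (t - v) ^ 2) :=
      FordL45.integrable_inv_sq_add_sq (by norm_num) t
    have hI2 := FordL45.integrable_log_div t
    have hψ : Integrable fun v : ℝ ↦ a' * (1 / ((3 / 2 : ℝ) ^ 2 + (t - v) ^ 2)) +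
        1 / 2 * (Real.log (1 + v ^ 2 / 9) / (9 / 4 + (t - v) ^ 2)) := (hI1.const_mul _).add (hI2.const_mul _)
    refine ((hψ.const_mul D)).mono' ?_ (ae_of_all _ fun y ↦ ?_)
    · refine (Continuous.aestronglyMeasurable ?_)
      refine continuous_const.mul ((Continuous.div (by
        exact continuous_const.add (continuous_const.mul (Continuous.log (by fun_prop)
          (fun y ↦ by positivity)))) (by fun_prop) (fun y ↦ by positivity)))
    · have hv4 : 0 ≤ Real.log (1 + y ^ 2 / 4) := Real.log_nonneg (by nlinarith)
      have hv9 : 0 ≤ Real.log (1 + y ^ 2 / 9) := Real.log_nonneg (by nlinarith)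
      have hql := log_quarter_le y
      have hnum : 0 ≤ 8.21 + Real.log q + 1 / 2 * Real.log (1 + y ^ 2 / 4) := by positivity
      have hnum' : 8.21 + Real.log q + 1 / 2 * Real.log (1 + y ^ 2 / 4) ≤
          a' + 1 / 2 * Real.log (1 + y ^ 2 / 9) := by rw [ha']; linarith
      have hden : 0 < 9 / 4 + (t - y) ^ 2 := by positivity
      have hc2 : 9 / 4 + (t - y) ^ 2 ≤ c ^ 2 + (t - y) ^ 2 := by nlinarith
      rw [Real.norm_eq_abs, abs_of_nonneg (mul_nonneg hD0 (div_nonneg hnum (by positivity)))]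
      refine mul_le_mul_of_nonneg_left ?_ hD0
      calc (8.21 + Real.log q + 1 / 2 * Real.log (1 + y ^ 2 / 4)) / (c ^ 2 + (t - y) ^ 2)
          ≤ (8.21 + Real.log q + 1 / 2 * Real.log (1 + y ^ 2 / 4)) / (9 / 4 + (t - y) ^ 2) :=
            div_le_div_of_nonneg_left hnum hden hc2
        _ ≤ (a' + 1 / 2 * Real.log (1 + y ^ 2 / 9)) / (9 / 4 + (t - y) ^ 2) :=
            div_le_div_of_nonneg_right hnum' hden.le
        _ = _ := by norm_num; ring
  have hGint : Integrable fun y : ℝ ↦ khaleIntegrand χ f s (((-(1 / 2) : ℝ) : ℂ) + y * I) :=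
    hmaj.mono' hGcont.aestronglyMeasurable (ae_of_all _ hbound)
  refine ⟨hGint, ?_⟩
  calc ‖∫ y : ℝ, khaleIntegrand χ f s (((-(1 / 2) : ℝ) : ℂ) + y * I)‖
      ≤ ∫ y : ℝ, ‖khaleIntegrand χ f s (((-(1 / 2) : ℝ) : ℂ) + y * I)‖ := norm_integral_le_integral_norm _
    _ ≤ ∫ y : ℝ, D * ((8.21 + Real.log q + 1 / 2 * Real.log (1 + y ^ 2 / 4)) / (c ^ 2 + (t - y) ^ 2)) :=
        integral_mono hGint.norm hmaj hbound
    _ = D * ∫ y : ℝ, (8.21 + Real.log q + 1 / 2 * Real.log (1 + y ^ 2 / 4)) / (c ^ 2 + (t - y) ^ 2) :=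
        MeasureTheory.integral_const_mul _ _

/-- **The left edge, bounded**: for `χ` primitive modulo `q ≥ 3`, an admissible smoothing,
`0 < η ≤ 1/2`, `Re s ≥ 1`:
`‖∫ G(−1/2 + iy) dy‖ ≤ D (2π (8.21 + log q + log(3/2))/3 + ⅓(π log(1 + t²) + 2π log 2))`,
`t = Im s`. [cite: Khale2024, Lemma 6.5 (proof)] -/
theorem integral_left_bound (hprim : χ.IsPrimitive) (hq : 3 ≤ q) {f : ℝ → ℝ} {η D : ℝ}
    (hf : IsFordSmoothing f η D) (hη : 0 < η) (hη2 : η ≤ 1 / 2) {s : ℂ} (hs1 : 1 ≤ s.re) :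
    Integrable (fun y : ℝ ↦ khaleIntegrand χ f s (((-(1 / 2) : ℝ) : ℂ) + y * I)) ∧
    ‖∫ y : ℝ, khaleIntegrand χ f s (((-(1 / 2) : ℝ) : ℂ) + y * I)‖ ≤
      D * (2 * π * ((8.21 + Real.log q + Real.log (3 / 2)) / 3) +
        1 / 3 * (π * Real.log (1 + s.im ^ 2) + 2 * π * Real.log 2)) := by
  obtain ⟨hI, hle⟩ := norm_integral_left_le hprim hq hf hη hη2 hs1
  have hD0 := hf.D_nonneg (by linarith)
  have hc32 : 3 / 2 ≤ s.re + 1 / 2 := by linarith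
  have hq1 : (1 : ℝ) ≤ q := by exact_mod_cast NeZero.one_le
  have ha : (0 : ℝ) ≤ 8.21 + Real.log q := by
    have := Real.log_nonneg hq1
    positivity
  exact ⟨hI, hle.trans (mul_le_mul_of_nonneg_left (error_integral_le ha hc32 s.im) hD0)⟩

/-! ### The horizontal edges at good heights -/

/-- **The horizontal edges.** Given a strip bound of the shape supplied, for primitive `χ`, by
`ExplicitPsiChar.exists_norm_logDeriv_LFunction_le_strip` (constant `C`): at a height `T'` with
`|T'| ≥ 2`, all non-trivial zeros `ε`-away from the ordinate `T'` (`0 < ε ≤ 1`), and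
`|T'| ≥ |Im s| + η`,
`‖∫_{−1/2}^{α} G(x + iT') dx‖ ≤ (α + ½)·(C ℒ/ε)·D/(|T'| − |Im s|)²`, `ℒ = log q + log(|T'| + 4)`
(`1 < α ≤ 3/2`, `α < Re s`). [cite: Khale2024, Lemma 6.5 (proof)] -/
theorem norm_integral_horizontal_le {f : ℝ → ℝ} {η D : ℝ}
    (hf : IsFordSmoothing f η D) (hη : 0 < η) (hη2 : η ≤ 1 / 2) {s : ℂ} {α : ℝ} (hα : 1 < α)
    (hα2 : α ≤ 3 / 2) (hαs : α < s.re) {C : ℝ} (hC0 : 0 < C)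
    (hC : ∀ (t ε : ℝ), 2 ≤ |t| → 0 < ε → ε ≤ 1 →
      (∀ ρ : ℂ, χ.LFunction ρ = 0 → 0 < ρ.re → ρ.re < 1 → ε ≤ |ρ.im - t|) →
      ∀ σ : ℝ, σ ∈ Icc (-(1 / 2) : ℝ) (3 / 2) →
        χ.LFunction (σ + t * I) ≠ 0 ∧
          ‖logDeriv χ.LFunction (σ + t * I)‖ ≤ C * (Real.log q + Real.log (|t| + 4)) / ε)
    {T' ε : ℝ} (hT' : 2 ≤ |T'|) (hε : 0 < ε) (hε1 : ε ≤ 1)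
    (hsep : ∀ ρ : ℂ, χ.LFunction ρ = 0 → 0 < ρ.re → ρ.re < 1 → ε ≤ |ρ.im - T'|)
    (hfar : |s.im| + η ≤ |T'|) :
    ‖∫ x : ℝ in (-(1 / 2) : ℝ)..α, khaleIntegrand χ f s (x + T' * I)‖ ≤
      (C * (Real.log q + Real.log (|T'| + 4)) / ε) * (D / (|T'| - |s.im|) ^ 2) * (α + 1 / 2) := by
  have hD0 := hf.D_nonneg (by linarith)
  have hpos : 0 < |T'| - |s.im| := by linarith
  have hq1 : (1 : ℝ) ≤ q := by exact_mod_cast NeZero.one_le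
  have hlogq : 0 ≤ Real.log q := Real.log_nonneg hq1
  have hlog : 0 ≤ C * (Real.log q + Real.log (|T'| + 4)) / ε := by
    have : 0 ≤ Real.log (|T'| + 4) := Real.log_nonneg (by linarith [abs_nonneg T'])
    positivity
  have hK : ∀ x ∈ Set.uIoc (-(1 / 2) : ℝ) α, ‖khaleIntegrand χ f s (x + T' * I)‖ ≤
      (C * (Real.log q + Real.log (|T'| + 4)) / ε) * (D / (|T'| - |s.im|) ^ 2) := by
    intro x hx
    rw [Set.uIoc_of_le (by linarith)] at hx
    have hx' : x ∈ Icc (-(1 / 2) : ℝ) (3 / 2) := ⟨hx.1.le, hx.2.trans hα2⟩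
    rw [khaleIntegrand, norm_mul, norm_neg]
    have h1 := (hC T' ε hT' hε hε1 hsep x hx').2
    rw [logDeriv_apply] at h1
    set w : ℂ := (x : ℂ) + T' * I with hw
    have hre : 0 ≤ (s - w).re := by simp [hw]; linarith [hx.2]
    have him : |T'| - |s.im| ≤ |(s - w).im| := by
      simp only [hw, sub_im, add_im, ofReal_im, mul_im, ofReal_re, I_im, mul_one, I_re, mul_zero,
        add_zero, zero_add]
      have := abs_sub_abs_le_abs_sub T' s.im
      rw [abs_sub_comm] at this
      linarith
    have hnorm : |T'| - |s.im| ≤ ‖s - w‖ := him.trans (Complex.abs_im_le_norm _)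
    have hη' : η ≤ ‖s - w‖ := by linarith
    have h2 := hf.laplace_bound (s - w) hre hη'
    rw [fordLaplace₀]
    calc ‖deriv χ.LFunction w / χ.LFunction w‖ * ‖fordLaplace f (s - w) - (f 0 : ℂ) / (s - w)‖
        ≤ (C * (Real.log q + Real.log (|T'| + 4)) / ε) * (D / ‖s - w‖ ^ 2) :=
          mul_le_mul h1 h2 (norm_nonneg _) hlog
      _ ≤ (C * (Real.log q + Real.log (|T'| + 4)) / ε) * (D / (|T'| - |s.im|) ^ 2) := by
          refine mul_le_mul_of_nonneg_left ?_ hlog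
          exact div_le_div_of_nonneg_left hD0 (pow_pos hpos 2) (pow_le_pow_left₀ hpos.le hnorm 2)
  have h := intervalIntegral.norm_integral_le_of_norm_le_const hK
  rw [show |α - (-(1 / 2) : ℝ)| = α + 1 / 2 by rw [abs_of_pos (by linarith)]; ring] at h
  exact h

/-! ### The zero sum: near zeros kept, far zeros and `ρ = 0` bounded by (6.5) -/

/-- **Real part of the zero sum over the rectangle from below.** For `χ` primitive modulo `q ≥ 3`,
an admissible smoothing, `0 < η ≤ 1/2`, `Re s ≥ 1`, a bound `S` of the strict far-zero sum
`Σ_{|1+it−ρ|>η} m(ρ)/|1+it−ρ|²` (`t = Im s`), and `T > |t| + η`: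
`Σ_{|1+it−ρ| ≤ η} m(ρ) Re F₀(s−ρ) − D·S − D/|s|² ≤ Re Σ_{ρ ∈ rectZeros χ T} m(ρ) F₀(s − ρ)`:
the far non-trivial zeros satisfy `|F₀(s−ρ)| ≤ D/|s−ρ|² ≤ D/|1+it−ρ|²`, and the trivial zero
`ρ = 0` of an even character (`m(0) = 1`) contributes `Re F₀(s) ≥ −D/|s|²`.
[cite: Khale2024, Lemma 6.5 (proof) and Corollary 6.6 (proof)] -/
theorem nearSum_sub_le_re_zeroSum (hprim : χ.IsPrimitive) (hq : 3 ≤ q) {f : ℝ → ℝ} {η D : ℝ}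
    (hf : IsFordSmoothing f η D) (hη : 0 < η) (hη2 : η ≤ 1 / 2) {s : ℂ} (hs1 : 1 ≤ s.re) {S : ℝ}
    (hS : KhaleFarZeroSumLT χ s.im η S) {T : ℝ} (hT : |s.im| + η < T) :
    (∑ ρ ∈ KhaleL63.nearZeros χ s.im η, (zeroOrder χ ρ : ℝ) * (fordLaplace₀ f (s - ρ)).re)
        - D * S - D / ‖s‖ ^ 2 ≤
      (∑ ρ ∈ rectZeros χ T, (zeroOrder χ ρ : ℂ) * fordLaplace₀ f (s - ρ)).re := by
  classical
  have hχ := ne_one hprim hq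
  have hD0 := hf.D_nonneg (by linarith)
  set t := s.im with ht
  set W := rectZeros χ T with hW
  set P : ℂ → Prop := fun ρ ↦ ‖1 + t * I - ρ‖ ≤ η with hP
  have hre : (∑ ρ ∈ W, (zeroOrder χ ρ : ℂ) * fordLaplace₀ f (s - ρ)).re =
      ∑ ρ ∈ W, (zeroOrder χ ρ : ℝ) * (fordLaplace₀ f (s - ρ)).re := by
    rw [Complex.re_sum]
    refine Finset.sum_congr rfl fun ρ _ ↦ ?_
    simp [Complex.mul_re]
  rw [hre, ← Finset.sum_filter_add_sum_filter_not W P]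
  -- the near part
  have hnear : W.filter P = KhaleL63.nearZeros χ t η := by
    ext z
    simp only [Finset.mem_filter, hW, hP, mem_rectZeros hχ, KhaleL63.mem_nearZeros hχ]
    constructor
    · rintro ⟨⟨h0, -, -⟩, hz⟩
      exact ⟨h0, hz⟩
    · rintro ⟨h0, hz⟩
      have hre_eq : (1 + t * I - z).re = 1 - z.re := by simp
      have him_eq : (1 + t * I - z).im = t - z.im := by simp
      have h1 := Complex.abs_re_le_norm (1 + t * I - z)
      have h2 := Complex.abs_im_le_norm (1 + t * I - z)
      rw [hre_eq] at h1
      rw [him_eq] at h2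
      have hr' : |1 - z.re| ≤ η := h1.trans hz
      have hi' : |t - z.im| ≤ η := h2.trans hz
      refine ⟨⟨h0, by linarith [(abs_le.1 hr').2], ?_⟩, hz⟩
      have := abs_sub_abs_le_abs_sub z.im t
      rw [abs_sub_comm] at this
      exact abs_lt.2 ⟨by linarith [abs_nonneg z.im, (abs_lt.1 (show |z.im| < T by linarith)).1],
        by linarith [(abs_lt.1 (show |z.im| < T by linarith)).2]⟩
  -- the far part: split off `ρ = 0`
  set W' := W.filter (fun ρ ↦ ¬P ρ) with hW'
  have hW'prop : ∀ ρ ∈ W', χ.LFunction ρ = 0 ∧ η < ‖1 + t * I - ρ‖ ∧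
      ((ρ = 0 ∧ zeroOrder χ 0 = 1) ∨ (0 < ρ.re ∧ ρ.re < 1)) := by
    intro ρ hρ
    simp only [hW', Finset.mem_filter, hW, mem_rectZeros hχ, hP, not_le] at hρ
    obtain ⟨⟨h0, hre, -⟩, hfarρ⟩ := hρ
    exact ⟨h0, hfarρ, zero_dichotomy hprim hq h0 hre.le⟩
  -- pointwise lower bound for every far zero (including `0`)
  have hpt : ∀ ρ ∈ W', -(D * ((zeroOrder χ ρ : ℝ) / ‖1 + t * I - ρ‖ ^ 2)) ≤
      (zeroOrder χ ρ : ℝ) * (fordLaplace₀ f (s - ρ)).re := by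
    intro ρ hρ
    obtain ⟨h0, hηρ, hcases⟩ := hW'prop ρ hρ
    have hm : (0 : ℝ) ≤ (zeroOrder χ ρ : ℝ) := Nat.cast_nonneg _
    have hlt1 : ρ.re < 1 := DirichletDetector.re_lt_one_of_LFunction_eq_zero hχ h0
    have hns := norm_one_add_sub_le_norm_sub (s := s) (ρ := ρ) hs1 hlt1
    have hpos : 0 < ‖1 + t * I - ρ‖ := hη.trans hηρ
    have hb := hf.laplace_bound (s - ρ) (by simp; linarith) (hηρ.le.trans hns)
    rw [← fordLaplace₀] at hb
    have hb' : ‖fordLaplace₀ f (s - ρ)‖ ≤ D / ‖1 + t * I - ρ‖ ^ 2 :=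
      hb.trans (div_le_div_of_nonneg_left hD0 (by positivity) (pow_le_pow_left₀ hpos.le hns 2))
    have hre := (Complex.abs_re_le_norm (fordLaplace₀ f (s - ρ))).trans hb'
    have := (abs_le.1 hre).1
    have hmul := mul_le_mul_of_nonneg_left this hm
    calc -(D * ((zeroOrder χ ρ : ℝ) / ‖1 + t * I - ρ‖ ^ 2))
        = (zeroOrder χ ρ : ℝ) * (-(D / ‖1 + t * I - ρ‖ ^ 2)) := by ring
      _ ≤ _ := hmul
  -- the non-trivial far zeros
  set W₁ := W'.filter (fun ρ ↦ ρ ≠ 0) with hW₁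
  set W₀ := W'.filter (fun ρ ↦ ¬ (ρ ≠ 0)) with hW₀
  have hTS := hS W₁ (by
    intro z hz
    rw [hW₁, Finset.mem_filter] at hz
    obtain ⟨h0, hfarz, hcases⟩ := hW'prop z hz.1
    rcases hcases with ⟨hz0, -⟩ | ⟨h1, h2⟩
    · exact absurd hz0 hz.2
    · exact ⟨h0, h1, h2, hfarz⟩)
  have hfar₁ : -(D * S) ≤ ∑ ρ ∈ W₁, (zeroOrder χ ρ : ℝ) * (fordLaplace₀ f (s - ρ)).re := by
    calc -(D * S) ≤ -(D * ∑ ρ ∈ W₁, (zeroOrder χ ρ : ℝ) / ‖1 + t * I - ρ‖ ^ 2) := by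
            have := mul_le_mul_of_nonneg_left hTS hD0
            linarith
      _ = ∑ ρ ∈ W₁, -(D * ((zeroOrder χ ρ : ℝ) / ‖1 + t * I - ρ‖ ^ 2)) := by
            rw [Finset.mul_sum, ← Finset.sum_neg_distrib]
      _ ≤ _ := Finset.sum_le_sum fun ρ hρ ↦ hpt ρ (Finset.mem_filter.1 hρ).1
  -- the trivial zero `0`
  have hfar₀ : -(D / ‖s‖ ^ 2) ≤ ∑ ρ ∈ W₀, (zeroOrder χ ρ : ℝ) * (fordLaplace₀ f (s - ρ)).re := by
    have hsub : W₀ ⊆ {0} := by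
      intro ρ hρ
      rw [hW₀, Finset.mem_filter, not_not] at hρ
      exact Finset.mem_singleton.2 hρ.2
    rcases Finset.subset_singleton_iff.1 hsub with h | h
    · rw [h, Finset.sum_empty]
      have : 0 ≤ D / ‖s‖ ^ 2 := by positivity
      linarith
    · rw [h, Finset.sum_singleton]
      have h0W : (0 : ℂ) ∈ W' := by
        have : (0 : ℂ) ∈ W₀ := by rw [h]; exact Finset.mem_singleton_self 0
        exact (Finset.mem_filter.1 this).1
      obtain ⟨-, -, hcases⟩ := hW'prop 0 h0W
      have hm1 : zeroOrder χ 0 = 1 := by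
        rcases hcases with ⟨-, h1⟩ | ⟨h1, -⟩
        · exact h1
        · simp at h1
      have hsre : 1 ≤ ‖s‖ := by
        have h1 := Complex.abs_re_le_norm s
        rw [abs_of_pos (show (0 : ℝ) < s.re by linarith)] at h1
        linarith
      have hb := hf.laplace_bound s (by linarith) (by linarith)
      rw [← fordLaplace₀] at hb
      have hre0 := (abs_le.1 ((Complex.abs_re_le_norm (fordLaplace₀ f s)).trans hb)).1
      rw [hm1, sub_zero]
      push_cast
      linarith
  have hsplit : ∑ ρ ∈ W', (zeroOrder χ ρ : ℝ) * (fordLaplace₀ f (s - ρ)).re =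
      (∑ ρ ∈ W₁, (zeroOrder χ ρ : ℝ) * (fordLaplace₀ f (s - ρ)).re) +
        ∑ ρ ∈ W₀, (zeroOrder χ ρ : ℝ) * (fordLaplace₀ f (s - ρ)).re :=
    (Finset.sum_filter_add_sum_filter_not W' (fun ρ ↦ ρ ≠ 0) _).symm
  rw [hnear, hsplit]
  linarith

/-! ### Lemma 6.5 (primitive case) as an inequality for the real part -/

set_option maxHeartbeats 800000 in
/-- **The core of Lemma 6.5 (primitive `χ` mod `q ≥ 3`), real part, with the left line as a
parameter.** For an admissible smoothing, `0 < η ≤ 1/2`, `1 < Re s ≤ 2`, a bound `S` of the strict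
far-zero sum, and any bound `Λ₀` of `‖∫ G(−1/2 + iy) dy‖`:
`Re K_χ(s) ≤ −f(0) Re L'/L(s, χ) − Σ_{|1+it−ρ|≤η} m(ρ) Re F₀(s−ρ) + D·S + D/|s|² + Λ₀/(2π)`.
This is (6.6): `contour_identity` along the good heights of `ExplicitPsiChar.exists_goodHeight`,
horizontal sides `→ 0`, right side `→ 2π(K_χ + f(0)L'/L)` (`integral_right_eq`), left side
`→ ∫ G(−1/2 + iy) dy`, and at each finite height the zero sum split by `nearSum_sub_le_re_zeroSum`.
[cite: Khale2024, Lemma 6.5 and proof of Corollary 6.6] -/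
theorem re_khaleK_le_of_left_bound (hprim : χ.IsPrimitive) (hq : 3 ≤ q) {f : ℝ → ℝ} {η D : ℝ}
    (hf : IsFordSmoothing f η D) (hη : 0 < η) (hη2 : η ≤ 1 / 2) {s : ℂ} (hs1 : 1 < s.re)
    (hs2 : s.re ≤ 2) {S : ℝ} (hS : KhaleFarZeroSumLT χ s.im η S) {Λ₀ : ℝ}
    (hΛ : ‖∫ y : ℝ, khaleIntegrand χ f s (((-(1 / 2) : ℝ) : ℂ) + y * I)‖ ≤ Λ₀) :
    (khaleK χ f s).re ≤ -(f 0) * (deriv χ.LFunction s / χ.LFunction s).re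
      - (∑ ρ ∈ KhaleL63.nearZeros χ s.im η, (zeroOrder χ ρ : ℝ) * (fordLaplace₀ f (s - ρ)).re)
      + D * S + D / ‖s‖ ^ 2 + Λ₀ / (2 * π) := by
  have hχ := ne_one hprim hq
  have hq1 := one_lt_of_three_le hq
  obtain ⟨x₀, M, hx₀, hf0, -⟩ := hf.exists_support_bound
  have hfc := hf.contDiff.continuous
  have hD0 := hf.D_nonneg (by linarith)
  have hq1' : (1 : ℝ) ≤ q := by exact_mod_cast NeZero.one_le
  have hlogq : 0 ≤ Real.log q := Real.log_nonneg hq1'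
  set σ := s.re with hσ
  set t := s.im with ht
  set α : ℝ := (1 + σ) / 2 with hα
  have hα1 : 1 < α := by rw [hα]; linarith
  have hα2 : α ≤ 3 / 2 := by rw [hα]; linarith
  have hαs : α < s.re := by rw [hα]; linarith
  set G := khaleIntegrand χ f s with hG
  -- good heights
  obtain ⟨Cz, hCz0, hCz⟩ := ExplicitPsiChar.exists_norm_logDeriv_LFunction_le_strip
  obtain ⟨c₀, hc₀0, hc₀⟩ := ExplicitPsiChar.exists_goodHeight
  have hgh : ∀ N : ℕ, ∃ T : ℝ, 2 ≤ N → ((N : ℝ) ≤ T ∧ T ≤ N + 1 ∧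
      ∀ ρ : ℂ, χ.LFunction ρ = 0 → 0 < ρ.re → ρ.re < 1 →
        c₀ / (Real.log q + Real.log (|T| + 4)) ≤ |(|ρ.im|) - T|) := by
    intro N
    by_cases hN : 2 ≤ N
    · obtain ⟨T, hTmem, hT⟩ := hc₀ q χ hprim hq1 N (Nat.cast_nonneg N)
      exact ⟨T, fun _ ↦ ⟨hTmem.1, hTmem.2, hT⟩⟩
    · exact ⟨0, fun h ↦ absurd h hN⟩
  choose T hTprop using hgh
  have hTtop : Tendsto T atTop atTop := by
    refine tendsto_atTop_mono' atTop ?_ tendsto_natCast_atTop_atTop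
    filter_upwards [eventually_ge_atTop 2] with N hN using (hTprop N hN).1
  obtain ⟨N₀, hN₀⟩ := exists_nat_gt (2 * |t| + 2)
  have hbig : ∀ N : ℕ, max N₀ 2 ≤ N → 2 ≤ N ∧ |t| + 1 < T N ∧ (N : ℝ) / 2 ≤ T N - |t| := by
    intro N hN
    have hN2 : 2 ≤ N := le_of_max_le_right hN
    have hNN₀ : (N₀ : ℝ) ≤ N := by exact_mod_cast le_of_max_le_left hN
    have hT := (hTprop N hN2).1
    refine ⟨hN2, by linarith [abs_nonneg t], by linarith [abs_nonneg t]⟩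
  -- separation at a good height: `δ_N = min (c₀/ℒ_N) (1/2)` from both `T N` and `-T N`
  have hsepN : ∀ N : ℕ, 2 ≤ N → ∀ sgn : ℝ, (sgn = 1 ∨ sgn = -1) →
      ∀ ρ : ℂ, χ.LFunction ρ = 0 → 0 < ρ.re → ρ.re < 1 →
        min (c₀ / (Real.log q + Real.log (|T N| + 4))) (1 / 2) ≤ |ρ.im - sgn * T N| := by
    intro N hN2 sgn hsgn ρ h0 h1 h2
    obtain ⟨hT1, -, hT3⟩ := hTprop N hN2
    have hN2' : (2 : ℝ) ≤ N := by exact_mod_cast hN2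
    have hTpos : 2 ≤ T N := by linarith
    have h := hT3 ρ h0 h1 h2
    have hmin1 : min (c₀ / (Real.log q + Real.log (|T N| + 4))) (1 / 2) ≤
        c₀ / (Real.log q + Real.log (|T N| + 4)) := min_le_left _ _
    have hmin2 : min (c₀ / (Real.log q + Real.log (|T N| + 4))) (1 / 2) ≤ 1 / 2 := min_le_right _ _
    rcases hsgn with rfl | rfl
    · rw [one_mul]
      rcases le_or_gt 0 ρ.im with hi | hi
      · rw [abs_of_nonneg hi] at h; exact hmin1.trans h
      · have : |ρ.im - T N| = T N + |ρ.im| := by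
          rw [abs_of_neg hi, abs_of_neg (by linarith)]; ring
        rw [this]; linarith [abs_nonneg ρ.im]
    · rw [neg_one_mul, sub_neg_eq_add]
      rcases le_or_gt 0 ρ.im with hi | hi
      · rw [abs_of_nonneg (by linarith : 0 ≤ ρ.im + T N)]; linarith
      · have e : |ρ.im + T N| = |(|ρ.im|) - T N| := by
          rw [abs_of_neg hi, show -ρ.im - T N = -(ρ.im + T N) by ring, abs_neg]
        rw [e]; exact hmin1.trans h
  -- (1) the horizontal sides
  set Λq : ℝ := 1 + Real.log q with hΛq
  have hΛq1 : 1 ≤ Λq := by rw [hΛq]; linarith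
  set Kδ : ℝ := Λq / c₀ + 2 with hKδ
  have hKδ0 : 0 < Kδ := by positivity
  have hhor0 : ∀ sgn : ℝ, (sgn = 1 ∨ sgn = -1) →
      Tendsto (fun N : ℕ ↦ ∫ x : ℝ in (-(1 / 2) : ℝ)..α, G (x + ((sgn * T N : ℝ) : ℂ) * I))
        atTop (𝓝 0) := by
    intro sgn hsgn
    refine squeeze_zero_norm' ?_
      (by simpa using ((ZetaZeroSum.tendsto_log_sq_div.const_mul
        (Cz * Λq * Kδ * (D * 4) * 2))))
    filter_upwards [eventually_ge_atTop (max N₀ 2)] with N hN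
    obtain ⟨hN2, hsN, hgapN⟩ := hbig N hN
    obtain ⟨h1, h2, h3⟩ := hTprop N hN2
    have hN2' : (2 : ℝ) ≤ N := by exact_mod_cast hN2
    have hT2 : 2 ≤ T N := by linarith
    have hTpos : 0 < T N := by linarith
    have hTabs : |sgn * T N| = T N := by
      rcases hsgn with rfl | rfl <;> simp [abs_of_pos hTpos]
    have hTabs' : |T N| = T N := abs_of_pos hTpos
    set ℒ : ℝ := Real.log q + Real.log (T N + 4) with hℒ
    have hlog40 : 0 < Real.log (T N + 4) := Real.log_pos (by linarith)
    have hℒpos : 0 < ℒ := by rw [hℒ]; linarith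
    set ε : ℝ := min (c₀ / ℒ) (1 / 2) with hε
    have hε0 : 0 < ε := lt_min (by positivity) (by norm_num)
    have hε1 : ε ≤ 1 := (min_le_right _ _).trans (by norm_num)
    have hsep : ∀ ρ : ℂ, χ.LFunction ρ = 0 → 0 < ρ.re → ρ.re < 1 → ε ≤ |ρ.im - sgn * T N| := by
      intro ρ h0 hr1 hr2
      have := hsepN N hN2 sgn hsgn ρ h0 hr1 hr2
      rwa [hTabs'] at this
    have hbd := norm_integral_horizontal_le hf hη hη2 hα1 hα2 hαs hCz0 (hCz q χ hprim hq1)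
      (T' := sgn * T N) (ε := ε) (by rw [hTabs]; exact hT2) hε0 hε1 hsep (by rw [hTabs]; linarith)
    rw [hTabs] at hbd
    refine hbd.trans ?_
    set ℓ := Real.log ((N : ℝ) + 7) with hℓ
    have hℓ1 : 1 ≤ ℓ := by
      rw [hℓ, Real.le_log_iff_exp_le (by positivity)]; linarith [Real.exp_one_lt_d9]
    have hlog4 : Real.log (T N + 4) ≤ ℓ := Real.log_le_log (by linarith) (by linarith)
    have hℒle : ℒ ≤ Λq * ℓ := by
      rw [hℒ, hΛq]
      have : Real.log q ≤ Real.log q * ℓ := le_mul_of_one_le_right hlogq hℓ1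
      nlinarith
    have h1δ : 1 / ε ≤ Kδ * ℓ := by
      have hstep : 1 / ε ≤ ℒ / c₀ + 2 := by
        rcases min_cases (c₀ / ℒ) (1 / 2 : ℝ) with ⟨hmin, -⟩ | ⟨hmin, -⟩
        · rw [hε, hmin, one_div_div]
          linarith [div_nonneg hℒpos.le hc₀0.le]
        · rw [hε, hmin]
          have : 0 ≤ ℒ / c₀ := div_nonneg hℒpos.le hc₀0.le
          norm_num; linarith
      have h2 : ℒ / c₀ + 2 ≤ Kδ * ℓ := by
        rw [hKδ, add_mul]
        have e1 : ℒ / c₀ ≤ Λq / c₀ * ℓ := by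
          rw [div_mul_eq_mul_div, div_le_div_iff_of_pos_right hc₀0]; exact hℒle
        nlinarith
      exact hstep.trans h2
    have hN0 : (0 : ℝ) < N := by linarith
    have hℒ0 : 0 ≤ ℒ := hℒpos.le
    have e1 : Cz * ℒ / ε ≤ Cz * Λq * Kδ * ℓ ^ 2 := by
      calc Cz * ℒ / ε = Cz * ℒ * (1 / ε) := by ring
        _ ≤ Cz * (Λq * ℓ) * (Kδ * ℓ) :=
            mul_le_mul (mul_le_mul_of_nonneg_left hℒle hCz0.le) h1δ (by positivity) (by positivity)
        _ = Cz * Λq * Kδ * ℓ ^ 2 := by ring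
    have hsq : ((N : ℝ) / 2) ^ 2 ≤ (T N - |t|) ^ 2 := pow_le_pow_left₀ (by positivity) hgapN 2
    have hsq' : (N : ℝ) / 4 ≤ (T N - |t|) ^ 2 := by
      have h4 : ((N : ℝ) / 2) ^ 2 - (N : ℝ) / 4 = (N : ℝ) * ((N : ℝ) - 1) / 4 := by ring
      have h5 : 0 ≤ (N : ℝ) * ((N : ℝ) - 1) / 4 :=
        div_nonneg (mul_nonneg (by linarith) (by linarith)) (by norm_num)
      linarith
    have e2 : D / (T N - |t|) ^ 2 ≤ D * 4 / N :=
      (div_le_div_of_nonneg_left hD0 (by positivity) hsq').trans_eq (by rw [div_div_eq_mul_div])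
    have hα2' : α + 1 / 2 ≤ 2 := by linarith
    have hlhs0 : 0 ≤ Cz * ℒ / ε := by positivity
    have hmid0 : 0 ≤ D / (T N - |t|) ^ 2 := by positivity
    have hrhs0 : 0 ≤ Cz * Λq * Kδ * ℓ ^ 2 := by positivity
    have hDN : 0 ≤ D * 4 / N := by positivity
    calc Cz * ℒ / ε * (D / (T N - |t|) ^ 2) * (α + 1 / 2)
        ≤ Cz * Λq * Kδ * ℓ ^ 2 * (D * 4 / N) * 2 :=
          mul_le_mul (mul_le_mul e1 e2 hmid0 hrhs0) hα2' (by linarith) (mul_nonneg hrhs0 hDN)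
      _ = Cz * Λq * Kδ * (D * 4) * 2 * (ℓ ^ 2 / N) := by ring
  -- (2) the vertical sides
  obtain ⟨hIright, hvalright⟩ := integral_right_eq hχ hf hη hα1 hαs
  set R : ℂ := 2 * π * (khaleK χ f s + (f 0 : ℂ) * (deriv χ.LFunction s / χ.LFunction s)) with hR
  have hright : Tendsto (fun N : ℕ ↦ ∫ y : ℝ in (-T N)..T N, G ((α : ℂ) + y * I)) atTop (𝓝 R) := by
    have h := intervalIntegral_tendsto_integral hIright (tendsto_neg_atTop_atBot.comp hTtop) hTtop
    rwa [hvalright] at h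
  have hIleft := (norm_integral_left_le hprim hq hf hη hη2 (s := s) hs1.le).1
  set Lft : ℂ := ∫ y : ℝ, G (((-(1 / 2) : ℝ) : ℂ) + y * I) with hLft
  have hleft : Tendsto (fun N : ℕ ↦ ∫ y : ℝ in (-T N)..T N, G (((-(1 / 2) : ℝ) : ℂ) + y * I)) atTop
      (𝓝 Lft) :=
    intervalIntegral_tendsto_integral hIleft (tendsto_neg_atTop_atBot.comp hTtop) hTtop
  -- (3) the boundary integral and its limit
  have hlim1 : Tendsto (fun N : ℕ ↦
      Literature.Analysis.Complex.rectBoundaryIntegral G (-(1 / 2)) α (-T N) (T N)) atTop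
      (𝓝 (0 - 0 + I * R - I * Lft)) := by
    have hb := hhor0 (-1) (Or.inr rfl)
    have ht' := hhor0 1 (Or.inl rfl)
    simp only [neg_mul, one_mul] at hb ht'
    have := ((hb.sub ht').add (hright.const_mul I)).sub (hleft.const_mul I)
    refine this.congr fun N ↦ ?_
    simp only [Literature.Analysis.Complex.rectBoundaryIntegral]
  -- the truncated zero sums
  set Z : ℕ → ℂ := fun N ↦ ∑ ρ ∈ rectZeros χ (T N),
    (zeroOrder χ ρ : ℂ) * fordLaplace₀ f (s - ρ) with hZ
  have hid : ∀ᶠ N : ℕ in atTop,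
      Z N = -(Literature.Analysis.Complex.rectBoundaryIntegral G (-(1 / 2)) α (-T N) (T N) /
        (2 * π * I)) := by
    filter_upwards [eventually_ge_atTop (max N₀ 2)] with N hN
    obtain ⟨hN2, hsN, -⟩ := hbig N hN
    have hTpos : 0 < T N := by linarith [abs_nonneg t]
    have hident := contour_identity hprim hq hfc hx₀ hf0 hα1 hαs (T := T N) hTpos
      fun ρ h0 h1 h2 ↦ ⟨fun h ↦ ?_, fun h ↦ ?_⟩
    · have hπ : (2 * π * I : ℂ) ≠ 0 := by simp [Real.pi_ne_zero]
      rw [hZ]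
      simp only
      rw [hident]
      field_simp
    · have := hsepN N hN2 1 (Or.inl rfl) ρ h0 h1 h2
      rw [one_mul, h, sub_self, abs_zero] at this
      have hpos : 0 < min (c₀ / (Real.log q + Real.log (|T N| + 4))) (1 / 2) :=
        lt_min (div_pos hc₀0 (by
          have : 0 < Real.log (|T N| + 4) := Real.log_pos (by linarith [abs_nonneg (T N)])
          linarith)) (by norm_num)
      linarith
    · have := hsepN N hN2 (-1) (Or.inr rfl) ρ h0 h1 h2
      rw [neg_one_mul, h, sub_self, abs_zero] at this
      have hpos : 0 < min (c₀ / (Real.log q + Real.log (|T N| + 4))) (1 / 2) :=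
        lt_min (div_pos hc₀0 (by
          have : 0 < Real.log (|T N| + 4) := Real.log_pos (by linarith [abs_nonneg (T N)])
          linarith)) (by norm_num)
      linarith
  set Zlim : ℂ := -((0 - 0 + I * R - I * Lft) / (2 * π * I)) with hZlim
  have hZt : Tendsto Z atTop (𝓝 Zlim) := by
    have h := (hlim1.div_const (2 * π * I)).neg
    exact h.congr' (hid.mono fun N h ↦ h.symm)
  -- the inequality at finite height, and its limit
  set Near : ℝ := ∑ ρ ∈ KhaleL63.nearZeros χ t η, (zeroOrder χ ρ : ℝ) * (fordLaplace₀ f (s - ρ)).re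
  have hineq : ∀ᶠ N : ℕ in atTop, Near - D * S - D / ‖s‖ ^ 2 ≤ (Z N).re := by
    filter_upwards [eventually_ge_atTop (max N₀ 2)] with N hN
    obtain ⟨hN2, hsN, -⟩ := hbig N hN
    exact nearSum_sub_le_re_zeroSum hprim hq hf hη hη2 hs1.le hS (T := T N) (by linarith)
  have hlimre : Tendsto (fun N ↦ (Z N).re) atTop (𝓝 Zlim.re) := (Complex.continuous_re.tendsto _).comp hZt
  have hfinal : Near - D * S - D / ‖s‖ ^ 2 ≤ Zlim.re := ge_of_tendsto hlimre hineq
  -- evaluate `Re Zlim`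
  have hπ0 : (π : ℝ) ≠ 0 := Real.pi_ne_zero
  have hZlim_re : Zlim.re = -(khaleK χ f s).re
      - f 0 * (deriv χ.LFunction s / χ.LFunction s).re + Lft.re / (2 * π) := by
    have e : Zlim = -(khaleK χ f s + (f 0 : ℂ) * (deriv χ.LFunction s / χ.LFunction s))
        + Lft * (((1 / (2 * π) : ℝ)) : ℂ) := by
      rw [hZlim, hR]
      have hI : (2 * π * I : ℂ) ≠ 0 := by simp [Real.pi_ne_zero]
      have hπc : (π : ℂ) ≠ 0 := by exact_mod_cast Real.pi_ne_zero
      push_cast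
      field_simp
      ring
    rw [e]
    simp only [add_re, neg_re, Complex.mul_re, ofReal_re, ofReal_im, mul_zero, sub_zero]
    ring
  rw [hZlim_re] at hfinal
  have hLre : Lft.re / (2 * π) ≤ Λ₀ / (2 * π) :=
    div_le_div_of_nonneg_right ((Complex.re_le_norm Lft).trans hΛ) (by positivity)
  linarith

/-- **Khale 2024, Lemma 6.5, primitive case, real part** (with the far zeros bounded as in the
proof of Corollary 6.6).  Let `χ` be a primitive character modulo `q ≥ 3`, `f` an admissible
smoothing (`IsFordSmoothing f η D`, `0 < η ≤ 1/2`), `s = σ + it` with `1 < σ ≤ 2`, and `S` a bound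
for the strict far-zero sum `Σ_{|1+it−ρ|>η} m(ρ)/|1+it−ρ|²` over the non-trivial zeros.  Then
`Re K_χ(s) ≤ −f(0) Re L'/L(s, χ) − Σ_{|1+it−ρ|≤η} m(ρ) Re F₀(s−ρ) + D·S + D/|s|²`
`  + D ((8.21 + log q + log(3/2))/3 + (log 2)/3 + (1/6) log(1 + t²))`.
[cite: Khale2024, Lemma 6.5] -/
theorem re_khaleK_le (hprim : χ.IsPrimitive) (hq : 3 ≤ q) {f : ℝ → ℝ} {η D : ℝ}
    (hf : IsFordSmoothing f η D) (hη : 0 < η) (hη2 : η ≤ 1 / 2) {s : ℂ} (hs1 : 1 < s.re)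
    (hs2 : s.re ≤ 2) {S : ℝ} (hS : KhaleFarZeroSumLT χ s.im η S) :
    (khaleK χ f s).re ≤ -(f 0) * (deriv χ.LFunction s / χ.LFunction s).re
      - (∑ ρ ∈ KhaleL63.nearZeros χ s.im η, (zeroOrder χ ρ : ℝ) * (fordLaplace₀ f (s - ρ)).re)
      + D * S + D / ‖s‖ ^ 2
      + D * ((8.21 + Real.log q + Real.log (3 / 2)) / 3 + Real.log 2 / 3
          + 1 / 6 * Real.log (1 + s.im ^ 2)) := by
  have h := re_khaleK_le_of_left_bound hprim hq hf hη hη2 hs1 hs2 hS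
    (integral_left_bound hprim hq hf hη hη2 hs1.le).2
  have e : D * (2 * π * ((8.21 + Real.log q + Real.log (3 / 2)) / 3) +
      1 / 3 * (π * Real.log (1 + s.im ^ 2) + 2 * π * Real.log 2)) / (2 * π)
      = D * ((8.21 + Real.log q + Real.log (3 / 2)) / 3 + Real.log 2 / 3
          + 1 / 6 * Real.log (1 + s.im ^ 2)) := by
    field_simp
    ring
  linarith

/-- **Khale 2024, Lemma 6.5, primitive case, numerical form**: under the hypotheses of
`re_khaleK_le`,
`Re K_χ(s) ≤ −f(0) Re L'/L(s, χ) − Σ_{|1+it−ρ|≤η} m(ρ) Re F₀(s−ρ) + D·S + D/|s|²`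
`  + D (3.11 + ⅓ log q + (1/6) log(1 + t²))`
(`8.21/3 + log(3/2)/3 + (log 2)/3 = 3.1029…`; the printed error is
`D(3.44 + ⅓ log q + ⅓ log(1 + Im s))`, and `(1/6) log(1 + t²) ≤ ⅓ log(1 + t)` for `t ≥ 0`).
[cite: Khale2024, Lemma 6.5] -/
theorem re_khaleK_le' (hprim : χ.IsPrimitive) (hq : 3 ≤ q) {f : ℝ → ℝ} {η D : ℝ}
    (hf : IsFordSmoothing f η D) (hη : 0 < η) (hη2 : η ≤ 1 / 2) {s : ℂ} (hs1 : 1 < s.re)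
    (hs2 : s.re ≤ 2) {S : ℝ} (hS : KhaleFarZeroSumLT χ s.im η S) :
    (khaleK χ f s).re ≤ -(f 0) * (deriv χ.LFunction s / χ.LFunction s).re
      - (∑ ρ ∈ KhaleL63.nearZeros χ s.im η, (zeroOrder χ ρ : ℝ) * (fordLaplace₀ f (s - ρ)).re)
      + D * S + D / ‖s‖ ^ 2
      + D * (3.11 + Real.log q / 3 + 1 / 6 * Real.log (1 + s.im ^ 2)) := by
  have h := re_khaleK_le hprim hq hf hη hη2 hs1 hs2 hS
  have hD0 := hf.D_nonneg (by linarith)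
  have h2 := Real.log_two_lt_d9
  have h32 : Real.log (3 / 2) ≤ 0.4055 :=
    (Real.log_le_iff_le_exp (by norm_num)).2 (le_trans (b := ∑ i ∈ Finset.range 12,
      (0.4055 : ℝ) ^ i / i.factorial) (by norm_num [Finset.sum_range_succ, Nat.factorial])
      (Real.sum_le_exp_of_nonneg (by norm_num) 12))
  have hc : (8.21 + Real.log q + Real.log (3 / 2)) / 3 + Real.log 2 / 3
      ≤ 3.11 + Real.log q / 3 := by
    have : Real.log 2 ≤ 0.6932 := by linarith
    linarith
  nlinarith [mul_le_mul_of_nonneg_left hc hD0]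

end KhaleL65

end Literature.NumberTheory.LFunctions
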